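import Literature.IUT.HodgeTheaters.FrobenioidBridgeEx54ivInfKappaRecon
import HarnessLib

/-!
# [IUTchI] Example 5.4 (iv), p. 149: the archimedean residual `h₂₈` of the C2 lane — companion of
# `FrobenioidBridgeEx54ivInfKappaRecon.lean` ★ p672946 (GAP B = G-L5t9g8-1, item GB-14; abc-iut-L5-lead RULINGS #348 (B)
# «the RESIDUAL SET OF RECORD is FOUR — {h₁₉, h₁₁₀, h₂₈; hEq}» / #349 (2) «kernel carrier `C2ResidualsArch` OPTIONAL, ≤ 15-line
# proof-free append»; spec-keeper B 22:13:24Z (b) / 22:14:15Z)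

S. Mochizuki, *Inter-universal Teichmüller theory I*, kurims manuscript (May 2020), Example 5.4 (iv) p. 149 («… induced
[cf. … [AbsTopIII], Theorem 1.9, and [AbsTopIII], Corollaries 1.10, 2.8] by the given poly-morphism»), Definition 5.2
(vii)(viii) pp. 139–142 (archimedean `‡𝒟_v`: an Aut-holomorphic orbispace); S. Mochizuki, *Topics in Absolute Anabelian
Geometry III*, Cor 2.8 pp. 63–64 (tree: `ArchimedeanReconstruction.NFCurveData.ReconstructsAutHol`, the L4 shim ★ p408225).
([IUTchI] Ex 5.4 (iv) p.149) [claim: Mochizuki2012, status: disputed] (D-0012 claim key — THIS file is a record of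
HYPOTHESES plus a one-line reduction; nothing of the series is asserted; no side taken on [IUTchIII] Cor. 3.12).

## What is built

GB-14's residual record `D.C2Residuals G R` = {`h₁₉`, `h₁₁₀` BY NAME at GB-13's enriched model; `hEq`} names the
NON-ARCHIMEDEAN local provenance ([AbsTopIII] Cor 1.10 (iii)) but not the ARCHIMEDEAN one: the link's `locInfk x` at an
archimedean `x` is GB-02's archimedean MODEL layer (`localInfKappaLayerArch`, GAP-SIZING-B R3 label), whose provenance in
print is [AbsTopIII] Cor 2.8 through the Aut-holomorphic input `G.arch w` of GB-13's hypothesis structure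
(`InitialThetaDataCurveModelLocal.lean` :179; binder `(h₂₈ : ∀ w, (G.arch w).ReconstructsAutHol)` :329) — RULINGS #348 (B):
«a residual record naming Cor 1.10 but not Cor 2.8 UNDER-DECLARES».  Here:
* **`D.C2ResidualsArch G R`** — `C2Residuals G R` EXTENDED by the field `h₂₈ : ∀ w, (G.arch w).ReconstructsAutHol` (the
  FOUR-residual record of RULINGS #348 (B); GB-14's three-field record is its projection `toC2Residuals`);
* `c2ResidualsArch_iff` — it is `C2Residuals G R ∧ ∀ w, (G.arch w).ReconstructsAutHol`;
* `ex54ivInfKappaCompat_recon_under_residualsArch : D.C2ResidualsArch G R → Ex54ivInfKappaCompat (D.infKappaLinkRecon … R)`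
  — the C2 deciding statement under the four residuals, REDUCED to GB-14's three-residual statement (which itself
  discards the record: C2 = transported only; #348 (B) «`fun h ↦ … h.toC2Residuals`»).

HONEST LABELS.  (1) `h₂₈` is a hypothesis BY NAME at the datum's archimedean inputs `G.arch w` (interface DATA of the
hypothesis structure `G`); our typed `ReconstructsAutHol` is an `∃!` that FAILS at degenerate data (L4's instance-form
negative `AutHolWitness.exists_not_reconstructsAutHol` — a two-point datum with a pole everywhere), so the record is
inhabitable only for `G` whose `arch` is print-like: typed ≠ inhabited ≠ proved-in-print.  (2) COUNT-NEUTRAL: the token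
sentence and its rendering are the chair's (GB-15) and the director's (g13-D9/D9a), never this file's.  (3) One
`structure … : Prop` + theorems; no `instance`, no notation, no axiom, no `sorry`; nothing here asserts abc proved or refuted.
-/

noncomputable section

namespace Literature.IUT.HodgeTheaters

open _root_.NumberField
open Literature.AnabelianGeometry.AbsoluteAnabelian
open Literature.AnabelianGeometry.AbsoluteAnabelian.AbsTopIII

universe u

namespace InitialThetaData

section Residuals

variable {F K Fbar : Type u} [Field F] [NumberField F] [Field K] [NumberField K] [Algebra F K]
  [Field Fbar] [Algebra F Fbar] [Algebra K Fbar] {E : WeierstrassCurve F} [E.IsElliptic] {l : ℕ}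
  {Pb : BadPlacePredicates K} (D : InitialThetaData F K Fbar E l Pb)

/-- **`D.C2ResidualsArch G R` — the C2 residual record WITH the archimedean residual: the FOUR-residual set of record of
RULINGS #348 (B)** (spec-keeper B PIN v2 (3) / 22:13:24Z (b); kernel carrier optional per #349 (2)): GB-14's
`C2Residuals G R` = {`h₁₉ : Thm_1_9 (D.nfCurveModelLocal G)`, `h₁₁₀ : Cor_1_10_iii (D.nfCurveModelLocal G)`,
`hEq : ∃ φ, D.ReconEquivariantFor R φ`} EXTENDED by `h₂₈ : ∀ w, (G.arch w).ReconstructsAutHol` — [AbsTopIII] Cor 2.8 BY NAME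
at the Aut-holomorphic inputs of the archimedean places (GB-13's `LocalThetaGeometry.arch`, MODEL label R3).  A record of
HYPOTHESES, asserted by nobody; consumed by no proof (C2 = transported only). ([IUTchI] Ex 5.4 (iv) p.149)
[claim: Mochizuki2012, status: disputed] -/
structure C2ResidualsArch (G : D.LocalThetaGeometry) (R : D.ReconRatObjects) : Prop extends D.C2Residuals G R where
  /-- [AbsTopIII] Cor 2.8 BY NAME at every archimedean place `w` of `K`: the Aut-holomorphic input `G.arch w`
  reconstructs its Aut-holomorphic structure (`NFCurveData.ReconstructsAutHol`, L4 shim ★ p408225) -/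
  h₂₈ : ∀ w : InfinitePlace K, (G.arch w).ReconstructsAutHol

/-- The four-field record is the three-field record of GB-14 plus `h₂₈`. ([IUTchI] Ex 5.4 (iv) p.149)
[claim: Mochizuki2012, status: disputed] -/
theorem c2ResidualsArch_iff (G : D.LocalThetaGeometry) (R : D.ReconRatObjects) :
    D.C2ResidualsArch G R ↔ D.C2Residuals G R ∧ ∀ w : InfinitePlace K, (G.arch w).ReconstructsAutHol :=
  ⟨fun ρ => ⟨ρ.toC2Residuals, ρ.h₂₈⟩, fun h => ⟨h.1, h.2⟩⟩

end Residuals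

section Datum

variable {F K Fbar : Type u} [Field F] [NumberField F] [Field K] [NumberField K]
  [Algebra F K] [Field Fbar] [Algebra F Fbar] [Algebra K Fbar]
  {E : WeierstrassCurve F} [E.IsElliptic] {l : ℕ} {Pb : BadPlacePredicates K}
  (D : InitialThetaData F K Fbar E l Pb) (CG : D.geom.pe.CuspGalois) (hS : D.CuspClassesNormaliserStable) [Fact l.Prime]
  (M : D.TorsionMonodromy) (hA : D.geom.pe.ArrowCoveringClaims)
  (hI : ∀ k ∈ D.geom.pe.inertia D.geom.pe.ε1, M.tau (D.geom.embK k) = 0)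
  (B : ∀ v, v ∈ D.indexCopyBad → D.BadPairAt v) (ΛBad : ∀ v (h : v ∈ D.indexCopyBad), D.LocalArrowLaw CG hS (B v h).H)
  {Gv : D.IndexCopy → Subgroup (Fbar ≃ₐ[F] Fbar)}
  (ES : ∀ v, v ∈ D.indexCopyBad → EvalSectionBinder (D.localDataOfBadPairs CG hS M hA hI B ΛBad v) (Gv v))

/-- **The C2 deciding statement under the FOUR residuals {h₁₉, h₁₁₀, h₂₈; hEq} (RULINGS #348 (B))**, reduced to GB-14's
three-residual statement `ex54ivInfKappaCompat_recon_under_residuals` by the projection `toC2Residuals` (which in turn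
discards the record: the conclusion is `ex54ivInfKappaCompat_recon R`, for EVERY `R`, BY TRANSPORT).  HONEST LABEL:
residuals unused by design beyond the projection; «C2 = transported only»; COUNT-NEUTRAL (GB-15 is the chair's).
([IUTchI] Ex 5.4 (iv) p.149) [claim: Mochizuki2012, status: disputed] -/
theorem ex54ivInfKappaCompat_recon_under_residualsArch (G : D.LocalThetaGeometry) (R : D.ReconRatObjects) :
    D.C2ResidualsArch G R →
      BaseThetaDatum.S5Local.Ex54ivInfKappaCompat (D.infKappaLinkRecon CG hS M hA hI B ΛBad ES R) :=
  fun ρ => D.ex54ivInfKappaCompat_recon_under_residuals CG hS M hA hI B ΛBad ES G R ρ.toC2Residuals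

end Datum

end InitialThetaData

end Literature.IUT.HodgeTheaters

end
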